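import Mathlib
import Literature.Computability.AlgebraicComplexity.RealTauKnownCases
import Summits.ValiantsHypothesis.ValiantsHypothesis.Theorems.LacunarySymmetroidMatrixDescartesGramDual
import Summits.ValiantsHypothesis.ValiantsHypothesis.Theorems.LacunarySymmetroidMatrixDescartesGramDualSplitting

/-!
# `MatrixDescartes` (stmt-ValiantsHypothesis-18050) — Gram duality, part 3: the `J⁻¹`-ORTHOGONAL FRAME LAW,
# and the duality / splitting law in LETTER currency (factored PSD letters, rank-one letters)

HONEST FRAMING.  Cell `pub-symmetroid`, seat `val-sym-mdr-p2` (gen 19); helper file `--supports` the crux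
`Theses.LacunarySymmetroid.MatrixDescartes` (OPEN), NO closure claim; companion of `…GramDual` (the identity
`X^{ER}·det(X^eJ + V diag(X^δ) Vᵀ) = det J·X^{em+Σδ}·det(diag(X^{E−δ}) + X^{E−e}·VᵀJ⁻¹V)`) and `…GramDualSplitting`
(`J⁻¹`-orthogonal letter groups are additive).  Sector laws for the crux's class of pivot pencils with a
non-degenerate pivot; nothing here bears on the crux in its window, `stub_twoSided`, `DoorA26` / `DoorA34`,
registers, or `VP ≠ VNP`.

RESULTS (every size, all exponents on both sides of the pivot, `det J ≠ 0`, no symmetry / sign hypothesis on `J`):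
* **`card_posRoots_le_card_neg_of_frame` (THE FRAME LAW).**  If the letter columns are pairwise `J⁻¹`-ORTHOGONAL
  (`(VᵀJ⁻¹V)_{jj'} = 0` for `j ≠ j'`), the dual word is DIAGONAL, `det` of the word is `det J · X^{…} · ∏ⱼ
  (X^{E−δⱼ} + cⱼ X^{E−e})` with `cⱼ = vⱼᵀJ⁻¹vⱼ`, and `Z₊ ≤ #{j : vⱼᵀJ⁻¹vⱼ < 0}`: each `J⁻¹`-NEGATIVE column
  contributes at most one positive zero, `J⁻¹`-positive and `J⁻¹`-isotropic columns none — whatever the exponents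
  (`card_posRoots_prod_le`, `card_posRoots_binomial_le_one`, `posRoots_binomial_eq_empty`).
* **Letter currency** (`letters_eq_psdPart`): a family of FACTORED PSD letters `Pₖ = BₖᵀBₖ` (`Bₖ : ι × ι`, `k : κ`;
  every PSD matrix is of this form, tree `Literature.LinearAlgebra.Matrix.exists_eq_conjTranspose_mul_self_of_posSemidef`)
  at exponents `dₖ` is the column system `V_{i,(k,r)} = (Bₖ)_{r i}` on `κ × ι` with exponents `d_k`; hence
  **`card_posRoots_letters_split_le`**: two factored families with `B'ₖ' J⁻¹ Bₖᵀ = 0` for all `k, k'` are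
  ADDITIVE in `Z₊`, and **`posRoots_letters_eq_empty_of_null`**: `Bₖ J⁻¹ Bₖ'ᵀ = 0` for all `k, k'` ⇒ no positive
  zero at all.
* **Rank-one letters** (`rankOne_eq_psdPart`): `∑ₖ X^{dₖ} vₖvₖᵀ` is the column system `V_{ik} = (vₖ)ᵢ` on `κ`
  itself, so (`card_posRoots_rankOne_eq`) a word with `K'` rank-one PSD letters of ANY size `m` has exactly the
  positive zeros of a `K' × K'` pencil `diag(X^{E−dₖ}) + X^{E−e}·(vₖᵀJ⁻¹vₖ')_{kk'}` («rank-one words are small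
  pencils»), the frame law reads `Z₊ ≤ #{k : vₖᵀJ⁻¹vₖ < 0}` for pairwise `J⁻¹`-orthogonal directions
  (`card_posRoots_rankOne_le_of_frame`), and `J⁻¹`-orthogonal groups of directions split
  (`card_posRoots_rankOne_split_le`).
* **NSD pivots dualise to NSD pivots** (`gram_nonpos_of_pivot_nonpos`): if `J ≺ 0` (`det J ≠ 0`, `−J ⪰ 0`) the dual pivot
  `VᵀJ⁻¹V` is negative semidefinite — the NSD-pivot class (`…NsdPivot*`, `…MomentLaw`) is self-dual under
  (size `m`, `R` columns) ↔ (size `R`, pivot rank `≤ m`), with coordinate-projector letters on the dual side.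

[folklore] (Sylvester / block determinants / Descartes for binomials; the lacunary-pencil reading is this seat's.)
Axioms `propext`, `Classical.choice`, `Quot.sound`.
-/

-- layout Summits/ValiantsHypothesis/ValiantsHypothesis forces the duplicated namespace component
set_option linter.dupNamespace false

namespace Summit.ValiantsHypothesis.ValiantsHypothesis.Theorems.LacunarySymmetroidMatrixDescartes

open Polynomial Matrix Finset
open scoped BigOperators

namespace GramDual

variable {ι ρ κ κ₁ κ₂ : Type*} [Fintype ι] [DecidableEq ι] [Fintype ρ] [DecidableEq ρ]
  [Fintype κ] [DecidableEq κ] [Fintype κ₁] [DecidableEq κ₁] [Fintype κ₂] [DecidableEq κ₂]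

/-- the primal word `X^e • J + V · diag(X^{δ j}) · Vᵀ` over `ℝ[X]` (file-local notation, as in `…GramDual`) -/
local notation3 (prettyPrint := false) "𝔽[" e ", " J ", " V ", " δ "]" =>
  (((Polynomial.X : Polynomial ℝ) ^ (e : ℕ)) • (J : Matrix _ _ ℝ).map Polynomial.C
    + (V : Matrix _ _ ℝ).map Polynomial.C * Matrix.diagonal (fun j => (Polynomial.X : Polynomial ℝ) ^ (δ j : ℕ))
      * ((V : Matrix _ _ ℝ).map Polynomial.C)ᵀ)

/-- the PSD part alone, `V · diag(X^{δ j}) · Vᵀ` (file-local notation, as in `…GramDualSplitting`) -/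
local notation3 (prettyPrint := false) "ℙ[" V ", " δ "]" =>
  ((V : Matrix _ _ ℝ).map Polynomial.C * Matrix.diagonal (fun j => (Polynomial.X : Polynomial ℝ) ^ (δ j : ℕ))
      * ((V : Matrix _ _ ℝ).map Polynomial.C)ᵀ)

/-- the dual word `diag(X^{E − δ j}) + X^{E−e} • (VᵀJ⁻¹V)` over `ℝ[X]` (file-local notation, as in `…GramDual`) -/
local notation3 (prettyPrint := false) "𝔻[" E ", " e ", " J ", " V ", " δ "]" =>
  (Matrix.diagonal (fun j => (Polynomial.X : Polynomial ℝ) ^ ((E : ℕ) - δ j))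
    + ((Polynomial.X : Polynomial ℝ) ^ ((E : ℕ) - (e : ℕ))) •
      ((V : Matrix _ _ ℝ)ᵀ * (J : Matrix _ _ ℝ)⁻¹ * (V : Matrix _ _ ℝ)).map Polynomial.C)

/-! ## §1  Positive zeros of products and of binomials -/

/-- **Positive zeros of a finite product**: `Z₊(∏ gⱼ) ≤ Σ Z₊(gⱼ)`. [folklore] -/
theorem card_posRoots_prod_le {α : Type*} [DecidableEq α] (s : Finset α) (g : α → Polynomial ℝ) :
    ((∏ j ∈ s, g j).roots.toFinset.filter (fun t => 0 < t)).card
      ≤ ∑ j ∈ s, ((g j).roots.toFinset.filter (fun t => 0 < t)).card := by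
  classical
  induction s using Finset.induction_on with
  | empty => simp [Polynomial.roots_one]
  | insert a s ha ih =>
    rw [Finset.prod_insert ha, Finset.sum_insert ha]
    exact (card_posRoots_mul_le _ _).trans (Nat.add_le_add_left ih _)

/-- **A binomial with a non-negative second coefficient has no positive zero**: `X^p + c X^q`, `0 ≤ c`.
[folklore] -/
theorem posRoots_binomial_eq_empty (p q : ℕ) {c : ℝ} (hc : 0 ≤ c) :
    (((Polynomial.X : Polynomial ℝ) ^ p + Polynomial.C c * (Polynomial.X : Polynomial ℝ) ^ q).roots.toFinset.filter
        (fun t => 0 < t)) = ∅ := by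
  rw [Finset.filter_eq_empty_iff]
  intro t ht hpos
  rw [Multiset.mem_toFinset, Polynomial.mem_roots', Polynomial.IsRoot.def] at ht
  obtain ⟨-, hev⟩ := ht
  rw [Polynomial.eval_add, Polynomial.eval_pow, Polynomial.eval_X, Polynomial.eval_mul, Polynomial.eval_C,
    Polynomial.eval_pow, Polynomial.eval_X] at hev
  have h1 : 0 < t ^ p := pow_pos hpos _
  have h2 : 0 ≤ c * t ^ q := mul_nonneg hc (pow_nonneg hpos.le _)
  linarith

/-- **A binomial has at most one positive zero**: `X^p + c X^q`, any real `c` (the zero polynomial, possible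
when `p = q` and `c = −1`, has no counted zero). [folklore] (sparse Descartes, tree
`card_roots_toFinset_filter_pos_lt_card_support`) -/
theorem card_posRoots_binomial_le_one (p q : ℕ) (c : ℝ) :
    (((Polynomial.X : Polynomial ℝ) ^ p + Polynomial.C c * (Polynomial.X : Polynomial ℝ) ^ q).roots.toFinset.filter
        (fun t => 0 < t)).card ≤ 1 := by
  classical
  set g : Polynomial ℝ := (Polynomial.X : Polynomial ℝ) ^ p + Polynomial.C c * (Polynomial.X : Polynomial ℝ) ^ q
    with hg
  by_cases h0 : g = 0
  · rw [h0, Polynomial.roots_zero, Multiset.toFinset_zero, Finset.filter_empty, Finset.card_empty]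
    exact Nat.zero_le _
  have hsupp : g.support ⊆ {p, q} := by
    have h := Polynomial.support_binomial_subset p q (1 : ℝ) c
    rwa [map_one, one_mul] at h
  have hlt := Literature.Computability.AlgebraicComplexity.card_roots_toFinset_filter_pos_lt_card_support h0
  have hcard : g.support.card ≤ 2 := (Finset.card_le_card hsupp).trans (Finset.card_le_two)
  omega

/-! ## §2  The frame law -/

omit [Fintype ρ] in
/-- The dual word of a `J⁻¹`-orthogonal frame is diagonal. [folklore] -/
theorem dual_eq_diagonal_of_frame (J : Matrix ι ι ℝ) (V : Matrix ι ρ ℝ) (E e : ℕ) (δ : ρ → ℕ)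
    (hoff : ∀ j j', j ≠ j' → (Vᵀ * J⁻¹ * V) j j' = 0) :
    𝔻[E, e, J, V, δ]
      = Matrix.diagonal fun j => (Polynomial.X : Polynomial ℝ) ^ (E - δ j)
          + Polynomial.C ((Vᵀ * J⁻¹ * V) j j) * (Polynomial.X : Polynomial ℝ) ^ (E - e) := by
  refine Matrix.ext fun j j' => ?_
  simp only [Matrix.add_apply, Matrix.diagonal_apply, Matrix.smul_apply, Matrix.map_apply, smul_eq_mul]
  by_cases h : j = j'
  · subst h
    simp only [if_true]
    ring
  · rw [if_neg h, if_neg h, hoff j j' h, map_zero, mul_zero, add_zero]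

/-- **THE `J⁻¹`-ORTHOGONAL FRAME LAW.**  `det J ≠ 0`, `V : ι × ρ` real with PAIRWISE `J⁻¹`-ORTHOGONAL columns
(`(VᵀJ⁻¹V)_{jj'} = 0` for `j ≠ j'`), any exponents `e, δ`: the word `X^e J + V diag(X^δ) Vᵀ = X^e J + Σⱼ X^{δⱼ} vⱼvⱼᵀ`
has at most `#{j : vⱼᵀJ⁻¹vⱼ < 0}` distinct positive zeros of its determinant — one per `J⁻¹`-NEGATIVE column, none
for `J⁻¹`-positive or isotropic columns, at every size and on both sides of the pivot. [folklore] -/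
theorem card_posRoots_le_card_neg_of_frame (J : Matrix ι ι ℝ) (hJ : IsUnit J.det) (V : Matrix ι ρ ℝ) (e : ℕ)
    (δ : ρ → ℕ) (hoff : ∀ j j', j ≠ j' → (Vᵀ * J⁻¹ * V) j j' = 0) :
    ((Matrix.det (𝔽[e, J, V, δ])).roots.toFinset.filter (fun t => 0 < t)).card
      ≤ (Finset.univ.filter fun j => (Vᵀ * J⁻¹ * V) j j < 0).card := by
  classical
  set E : ℕ := e + ∑ j, δ j with hE
  have he : e ≤ E := Nat.le_add_right _ _
  have hδ : ∀ j, δ j ≤ E := fun j =>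
    (Finset.single_le_sum (f := δ) (fun i _ => Nat.zero_le _) (Finset.mem_univ j)).trans (Nat.le_add_left _ _)
  rw [posRoots_word_eq J hJ V e E δ he hδ, dual_eq_diagonal_of_frame J V E e δ hoff, Matrix.det_diagonal]
  refine (card_posRoots_prod_le _ _).trans ?_
  rw [Finset.card_filter]
  refine Finset.sum_le_sum fun j _ => ?_
  by_cases hneg : (Vᵀ * J⁻¹ * V) j j < 0
  · rw [if_pos hneg]
    exact card_posRoots_binomial_le_one _ _ _
  · rw [if_neg hneg, posRoots_binomial_eq_empty _ _ (not_lt.1 hneg), Finset.card_empty]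

/-! ## §3  Letter currency: factored PSD letters -/

/-- **Factored letters are a column system**: `∑ₖ X^{dₖ} • (BₖᵀBₖ) = V · diag(X^{δ}) · Vᵀ` with
`V_{i,(k,r)} = (Bₖ)_{r i}`, `δ_{(k,r)} = dₖ` on `κ × ι`. [folklore] -/
theorem letters_eq_psdPart (d : κ → ℕ) (B : κ → Matrix ι ι ℝ) :
    (∑ k, ((Polynomial.X : Polynomial ℝ) ^ d k) • ((B k)ᵀ * B k).map Polynomial.C)
      = ℙ[(Matrix.of fun (i : ι) (jr : κ × ι) => B jr.1 jr.2 i), (fun jr : κ × ι => d jr.1)] := by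
  refine Matrix.ext fun i i' => ?_
  have hL : (∑ k, ((Polynomial.X : Polynomial ℝ) ^ d k) • ((B k)ᵀ * B k).map Polynomial.C) i i'
      = ∑ k, ∑ r, (Polynomial.X : Polynomial ℝ) ^ d k * (Polynomial.C (B k r i) * Polynomial.C (B k r i')) := by
    rw [Matrix.sum_apply]
    refine Finset.sum_congr rfl fun k _ => ?_
    rw [Matrix.smul_apply, Matrix.map_apply, Matrix.mul_apply, smul_eq_mul, map_sum, Finset.mul_sum]
    refine Finset.sum_congr rfl fun r _ => ?_
    rw [Matrix.transpose_apply, map_mul]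
  have hR : (ℙ[(Matrix.of fun (i : ι) (jr : κ × ι) => B jr.1 jr.2 i), (fun jr : κ × ι => d jr.1)]) i i'
      = ∑ jr : κ × ι, Polynomial.C (B jr.1 jr.2 i) * (Polynomial.X : Polynomial ℝ) ^ d jr.1
          * Polynomial.C (B jr.1 jr.2 i') := by
    rw [Matrix.mul_apply]
    refine Finset.sum_congr rfl fun jr _ => ?_
    rw [Matrix.mul_diagonal, Matrix.transpose_apply, Matrix.map_apply, Matrix.map_apply, Matrix.of_apply,
      Matrix.of_apply]
  refine hL.trans (Eq.trans ?_ hR.symm)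
  rw [Fintype.sum_prod_type]
  refine Finset.sum_congr rfl fun k _ => ?_
  refine Finset.sum_congr rfl fun r _ => ?_
  ring

omit [Fintype κ₁] [DecidableEq κ₁] [Fintype κ₂] [DecidableEq κ₂] [DecidableEq ι] in
/-- Cross-Gram of two factored families: block `((k',r'),(k,r))` of `V₂ᵀJ⁻¹V₁` is `(B'ₖ' J⁻¹ Bₖᵀ)_{r' r}`.
[folklore] -/
theorem crossGram_letters [DecidableEq ι] (J : Matrix ι ι ℝ) (B : κ₁ → Matrix ι ι ℝ) (B' : κ₂ → Matrix ι ι ℝ)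
    (jr' : κ₂ × ι) (jr : κ₁ × ι) :
    ((Matrix.of fun (i : ι) (jr : κ₂ × ι) => B' jr.1 jr.2 i)ᵀ * J⁻¹
        * (Matrix.of fun (i : ι) (jr : κ₁ × ι) => B jr.1 jr.2 i)) jr' jr
      = (B' jr'.1 * J⁻¹ * (B jr.1)ᵀ) jr'.2 jr.2 := by
  simp only [Matrix.mul_apply, Matrix.transpose_apply, Matrix.of_apply, Finset.sum_mul]

/-- **SPLITTING LAW, letter currency.**  `det J ≠ 0`; two families of factored PSD letters `Pₖ = BₖᵀBₖ`
(`k : κ₁`, exponents `dₖ`) and `Qₖ' = B'ₖ'ᵀB'ₖ'` (`k' : κ₂`, exponents `d'ₖ'`) with `J⁻¹`-ORTHOGONAL RANGES,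
`B'ₖ' J⁻¹ Bₖᵀ = 0` for all `k, k'`.  Then
`Z₊(X^eJ + Σ X^{dₖ}Pₖ + Σ X^{d'ₖ'}Qₖ') ≤ Z₊(X^eJ + Σ X^{dₖ}Pₖ) + Z₊(X^eJ + Σ X^{d'ₖ'}Qₖ')`. [folklore] -/
theorem card_posRoots_letters_split_le (J : Matrix ι ι ℝ) (hJ : IsUnit J.det) (e : ℕ) (d : κ₁ → ℕ)
    (B : κ₁ → Matrix ι ι ℝ) (d' : κ₂ → ℕ) (B' : κ₂ → Matrix ι ι ℝ)
    (horth : ∀ k k', B' k' * J⁻¹ * (B k)ᵀ = 0) :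
    ((Matrix.det (((Polynomial.X : Polynomial ℝ) ^ e) • J.map Polynomial.C
        + (∑ k, ((Polynomial.X : Polynomial ℝ) ^ d k) • ((B k)ᵀ * B k).map Polynomial.C)
        + (∑ k, ((Polynomial.X : Polynomial ℝ) ^ d' k) • ((B' k)ᵀ * B' k).map Polynomial.C))
        ).roots.toFinset.filter (fun t => 0 < t)).card
      ≤ ((Matrix.det (((Polynomial.X : Polynomial ℝ) ^ e) • J.map Polynomial.C
            + ∑ k, ((Polynomial.X : Polynomial ℝ) ^ d k) • ((B k)ᵀ * B k).map Polynomial.C)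
            ).roots.toFinset.filter (fun t => 0 < t)).card
        + ((Matrix.det (((Polynomial.X : Polynomial ℝ) ^ e) • J.map Polynomial.C
            + ∑ k, ((Polynomial.X : Polynomial ℝ) ^ d' k) • ((B' k)ᵀ * B' k).map Polynomial.C)
            ).roots.toFinset.filter (fun t => 0 < t)).card := by
  classical
  rw [letters_eq_psdPart d B, letters_eq_psdPart d' B']
  refine card_posRoots_split_le J hJ _ _ e _ _ ?_
  ext jr' jr
  rw [crossGram_letters, horth, Matrix.zero_apply, Matrix.zero_apply]

/-- **NULL FAMILY, letter currency.**  `det J ≠ 0`; factored PSD letters `Pₖ = BₖᵀBₖ` whose ranges form a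
`J⁻¹`-NULL system (`Bₖ J⁻¹ Bₖ'ᵀ = 0` for ALL `k, k'`, including `k = k'`): the word `X^eJ + Σ X^{dₖ}Pₖ` has no
positive zero of its determinant. [folklore] -/
theorem posRoots_letters_eq_empty_of_null (J : Matrix ι ι ℝ) (hJ : IsUnit J.det) (e : ℕ) (d : κ → ℕ)
    (B : κ → Matrix ι ι ℝ) (hnull : ∀ k k', B k * J⁻¹ * (B k')ᵀ = 0) :
    (Matrix.det (((Polynomial.X : Polynomial ℝ) ^ e) • J.map Polynomial.C
        + ∑ k, ((Polynomial.X : Polynomial ℝ) ^ d k) • ((B k)ᵀ * B k).map Polynomial.C)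
        ).roots.toFinset.filter (fun t => 0 < t) = ∅ := by
  classical
  rw [letters_eq_psdPart d B]
  refine posRoots_eq_empty_of_gram_eq_zero J hJ _ e _ ?_
  ext jr' jr
  rw [crossGram_letters, hnull, Matrix.zero_apply, Matrix.zero_apply]

/-! ## §4  Rank-one letters: words of any size are `κ × κ` pencils -/

omit [Fintype ι] [DecidableEq ι] in
/-- **Rank-one letters are a column system on the letter type itself**: `∑ₖ X^{dₖ} • vₖvₖᵀ = V diag(X^d) Vᵀ`
with `V_{ik} = (vₖ)ᵢ`. [folklore] -/
theorem rankOne_eq_psdPart (d : κ → ℕ) (v : κ → ι → ℝ) :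
    (∑ k, ((Polynomial.X : Polynomial ℝ) ^ d k) • (Matrix.vecMulVec (v k) (v k)).map Polynomial.C)
      = ℙ[(Matrix.of fun (i : ι) (k : κ) => v k i), d] := by
  refine Matrix.ext fun i i' => ?_
  have hL : (∑ k, ((Polynomial.X : Polynomial ℝ) ^ d k) • (Matrix.vecMulVec (v k) (v k)).map Polynomial.C) i i'
      = ∑ k, (Polynomial.X : Polynomial ℝ) ^ d k * (Polynomial.C (v k i) * Polynomial.C (v k i')) := by
    rw [Matrix.sum_apply]
    refine Finset.sum_congr rfl fun k _ => ?_
    rw [Matrix.smul_apply, Matrix.map_apply, Matrix.vecMulVec_apply, smul_eq_mul, map_mul]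
  have hR : (ℙ[(Matrix.of fun (i : ι) (k : κ) => v k i), d]) i i'
      = ∑ k, Polynomial.C (v k i) * (Polynomial.X : Polynomial ℝ) ^ d k * Polynomial.C (v k i') := by
    rw [Matrix.mul_apply]
    refine Finset.sum_congr rfl fun k _ => ?_
    rw [Matrix.mul_diagonal, Matrix.transpose_apply, Matrix.map_apply, Matrix.map_apply, Matrix.of_apply,
      Matrix.of_apply]
  refine hL.trans (Eq.trans ?_ hR.symm)
  refine Finset.sum_congr rfl fun k _ => ?_
  ring

omit [Fintype κ] [DecidableEq κ] [DecidableEq ι] in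
/-- Gram matrix of a rank-one family: `(VᵀJ⁻¹V)_{kk'} = vₖᵀ J⁻¹ vₖ'`. [folklore] -/
theorem gram_rankOne [DecidableEq ι] (J : Matrix ι ι ℝ) (v : κ → ι → ℝ) (k k' : κ) :
    ((Matrix.of fun (i : ι) (k : κ) => v k i)ᵀ * J⁻¹ * (Matrix.of fun (i : ι) (k : κ) => v k i)) k k'
      = v k ⬝ᵥ (J⁻¹ *ᵥ v k') := by
  simp only [Matrix.mul_apply, Matrix.transpose_apply, Matrix.of_apply, dotProduct, Matrix.mulVec,
    Finset.sum_mul, Finset.mul_sum]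
  rw [Finset.sum_comm]
  refine Finset.sum_congr rfl fun i _ => Finset.sum_congr rfl fun i' _ => ?_
  ring

/-- **RANK-ONE WORDS ARE SMALL PENCILS.**  `det J ≠ 0`; rank-one PSD letters `vₖvₖᵀ` (`k : κ`) at exponents
`dₖ ≤ E`, `e ≤ E`: the word `X^eJ + Σₖ X^{dₖ} vₖvₖᵀ` (size `card ι`) has exactly the positive zeros of the
`κ × κ` pencil `diag(X^{E−dₖ}) + X^{E−e}·(vₖᵀJ⁻¹vₖ')` — diagonal monomial letters plus ONE constant Gram letter.
[folklore] -/
theorem card_posRoots_rankOne_eq (J : Matrix ι ι ℝ) (hJ : IsUnit J.det) (e E : ℕ) (d : κ → ℕ) (v : κ → ι → ℝ)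
    (he : e ≤ E) (hd : ∀ k, d k ≤ E) :
    ((Matrix.det (((Polynomial.X : Polynomial ℝ) ^ e) • J.map Polynomial.C
        + ∑ k, ((Polynomial.X : Polynomial ℝ) ^ d k) • (Matrix.vecMulVec (v k) (v k)).map Polynomial.C)
        ).roots.toFinset.filter (fun t => 0 < t)).card
      = ((Matrix.det (Matrix.diagonal (fun k => (Polynomial.X : Polynomial ℝ) ^ (E - d k))
          + ((Polynomial.X : Polynomial ℝ) ^ (E - e)) •
            (Matrix.of fun k k' : κ => v k ⬝ᵥ (J⁻¹ *ᵥ v k')).map Polynomial.C)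
          ).roots.toFinset.filter (fun t => 0 < t)).card := by
  classical
  have hG : (Matrix.of fun (i : ι) (k : κ) => v k i)ᵀ * J⁻¹ * (Matrix.of fun (i : ι) (k : κ) => v k i)
      = Matrix.of fun k k' : κ => v k ⬝ᵥ (J⁻¹ *ᵥ v k') := by
    refine Matrix.ext fun k k' => ?_
    rw [gram_rankOne, Matrix.of_apply]
  rw [rankOne_eq_psdPart d v, card_posRoots_word_eq J hJ _ e E d he hd, hG]

/-- **Frame law for rank-one letters**: pairwise `J⁻¹`-orthogonal directions (`vₖᵀJ⁻¹vₖ' = 0`, `k ≠ k'`) ⇒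
`Z₊(X^eJ + Σ X^{dₖ} vₖvₖᵀ) ≤ #{k : vₖᵀJ⁻¹vₖ < 0}`. [folklore] -/
theorem card_posRoots_rankOne_le_of_frame (J : Matrix ι ι ℝ) (hJ : IsUnit J.det) (e : ℕ) (d : κ → ℕ)
    (v : κ → ι → ℝ) (hoff : ∀ k k', k ≠ k' → v k ⬝ᵥ (J⁻¹ *ᵥ v k') = 0) :
    ((Matrix.det (((Polynomial.X : Polynomial ℝ) ^ e) • J.map Polynomial.C
        + ∑ k, ((Polynomial.X : Polynomial ℝ) ^ d k) • (Matrix.vecMulVec (v k) (v k)).map Polynomial.C)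
        ).roots.toFinset.filter (fun t => 0 < t)).card
      ≤ (Finset.univ.filter fun k => v k ⬝ᵥ (J⁻¹ *ᵥ v k) < 0).card := by
  classical
  rw [rankOne_eq_psdPart d v]
  refine (card_posRoots_le_card_neg_of_frame J hJ _ e d fun k k' hkk' => ?_).trans (le_of_eq ?_)
  · rw [gram_rankOne]; exact hoff k k' hkk'
  · congr 1
    ext k
    simp only [Finset.mem_filter, Finset.mem_univ, true_and, gram_rankOne]

/-- **Splitting law for rank-one letters**: two direction families with `vₖᵀJ⁻¹wₖ' = 0` for all `k, k'` are
additive in `Z₊`. [folklore] -/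
theorem card_posRoots_rankOne_split_le (J : Matrix ι ι ℝ) (hJ : IsUnit J.det) (e : ℕ) (d : κ₁ → ℕ)
    (v : κ₁ → ι → ℝ) (d' : κ₂ → ℕ) (w : κ₂ → ι → ℝ) (horth : ∀ k k', w k' ⬝ᵥ (J⁻¹ *ᵥ v k) = 0) :
    ((Matrix.det (((Polynomial.X : Polynomial ℝ) ^ e) • J.map Polynomial.C
        + (∑ k, ((Polynomial.X : Polynomial ℝ) ^ d k) • (Matrix.vecMulVec (v k) (v k)).map Polynomial.C)
        + (∑ k, ((Polynomial.X : Polynomial ℝ) ^ d' k) • (Matrix.vecMulVec (w k) (w k)).map Polynomial.C))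
        ).roots.toFinset.filter (fun t => 0 < t)).card
      ≤ ((Matrix.det (((Polynomial.X : Polynomial ℝ) ^ e) • J.map Polynomial.C
            + ∑ k, ((Polynomial.X : Polynomial ℝ) ^ d k) • (Matrix.vecMulVec (v k) (v k)).map Polynomial.C)
            ).roots.toFinset.filter (fun t => 0 < t)).card
        + ((Matrix.det (((Polynomial.X : Polynomial ℝ) ^ e) • J.map Polynomial.C
            + ∑ k, ((Polynomial.X : Polynomial ℝ) ^ d' k) • (Matrix.vecMulVec (w k) (w k)).map Polynomial.C)
            ).roots.toFinset.filter (fun t => 0 < t)).card := by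
  classical
  rw [rankOne_eq_psdPart d v, rankOne_eq_psdPart d' w]
  refine card_posRoots_split_le J hJ _ _ e _ _ (Matrix.ext fun k' k => ?_)
  simp only [Matrix.mul_apply, Matrix.transpose_apply, Matrix.of_apply, Matrix.zero_apply, Finset.sum_mul]
  have h := horth k k'
  simp only [dotProduct, Matrix.mulVec, Finset.mul_sum] at h
  rw [Finset.sum_comm]
  rw [← h]
  refine Finset.sum_congr rfl fun i _ => Finset.sum_congr rfl fun i' _ => ?_
  ring

/-! ## §5  NSD pivots dualise to NSD pivots -/

omit [DecidableEq ρ] in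
/-- **The dual pivot of an NSD-pivot word is NSD**: if `J` is non-degenerate and `−J ⪰ 0` (i.e. `J ≺ 0`) then
`VᵀJ⁻¹V` is negative semidefinite (`−(VᵀJ⁻¹V) = Vᵀ(−J)⁻¹V ⪰ 0`).  So the NSD-pivot class is self-dual: a word of
size `m` with `R` letter columns and pivot `J ≺ 0` has the positive zeros of a word of size `R` with
coordinate-projector PSD letters and the NSD pivot `VᵀJ⁻¹V` of rank `≤ m`. [folklore] -/
theorem gram_nonpos_of_pivot_nonpos (J : Matrix ι ι ℝ) (hJ : IsUnit J.det) (hJn : (-J).PosSemidef)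
    (V : Matrix ι ρ ℝ) : (-(Vᵀ * J⁻¹ * V)).PosSemidef := by
  have h1 : (-J) * (-J⁻¹) = 1 := by rw [neg_mul_neg, Matrix.mul_nonsing_inv _ hJ]
  have hinv : (-J)⁻¹ = -J⁻¹ := Matrix.inv_eq_right_inv h1
  have h : -(Vᵀ * J⁻¹ * V) = Vᵀ * (-J)⁻¹ * V := by
    rw [hinv, Matrix.mul_neg, Matrix.neg_mul]
  rw [h, ← Matrix.conjTranspose_eq_transpose_of_trivial]
  exact hJn.inv.conjTranspose_mul_mul_same V

end GramDual

end Summit.ValiantsHypothesis.ValiantsHypothesis.Theorems.LacunarySymmetroidMatrixDescartes
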